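import Mathlib
import Literature.Computability.AlgebraicComplexity.MatMulLieIsotropy
import Literature.Computability.AlgebraicComplexity.MatMulPolystableProofs
import Literature.Computability.AlgebraicComplexity.QuantumFunctionalsDegenerationProofs
import Literature.LinearAlgebra.Matrix.KroneckerSumDiagonalizable

/-!
# `HilbertMumfordHalf`, torus straightening: a diagonal torus fixing an `SL³`-translate of
# `⟨n,n,n⟩` is conjugate, inside the orbit, to a diagonal torus fixing `⟨n,n,n⟩` itself

Route `ToricBorderRank` of `MatrixMultiplication`, support item `HilbertMumfordHalf`
(stmt-MatrixMultiplication-9968), direction (⇒). The Hilbert–Mumford criterion produces a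
diagonal one-parameter subgroup `D(t) = (diag t^α, diag t^β, diag t^γ)` and a translate
`X = g·⟨n,n,n⟩` (`g ∈ SL³`) fixed by it, i.e. `X` is supported on the cells of weight
`α a + β b + γ c = 0`. The item, however, asks for diagonal weights relative to `⟨n,n,n⟩` ITSELF.
`straighten` supplies the missing conjugation: there are `s ∈ SL³` and integer weights
`α', β', γ'` with `s·X = ⟨n,n,n⟩` and `s` GRADED (`s₁ a' a ≠ 0 → α' a' = α a`, and likewise for
`β, γ`), so that `s` intertwines `D(t)` with the diagonal subgroup `D'(t)` of weights
`α', β', γ'`, which then fixes `⟨n,n,n⟩`.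

## Proof (de Groote's isotropy theorem in infinitesimal form, plus linear algebra)

Let `Dᵢ = diag(wᵢ)` and `ξᵢ = gᵢ⁻¹ Dᵢ gᵢ`. Since `X = g·M` (`M = ⟨n,n,n⟩`) lives on weight-zero
cells, the diagonal Lie operator `D₁⊗1⊗1 + 1⊗D₂⊗1 + 1⊗1⊗D₃` kills `X`
(`lieAct_diagonal_apply`), hence `(ξ₁, ξ₂, ξ₃)` lies in the Lie stabiliser of `M`
(`lie_transport`). By `lieStab_matMulTensor_iff` (the Lie algebra of de Groote's sandwich group)
`ξ₁ = -(p⊗1 + 1⊗qᵀ)`, `ξ₂ = pᵀ⊗1 + 1⊗r`, `ξ₃ = -(rᵀ⊗1) + 1⊗q`. Each `ξᵢ` is diagonalisable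
(conjugate to `Dᵢ`), so `pᵀ, r, q` are diagonalisable
(`exists_mul_eq_mul_diagonal_left/right_of_kroneckerSum`), say by `P, Q, R`. The sandwich
symmetry `h = (P⁻ᵀ⊗R⁻ᵀ, P⊗Q, Q⁻ᵀ⊗R)` fixes `M` (`actTensor_sandwich_matMulTensor`) and
`ξᵢ hᵢ = hᵢ Λᵢ` with `Λᵢ` diagonal; therefore `s̃ᵢ := hᵢ⁻¹ gᵢ⁻¹` satisfies `s̃·X = M` and
`s̃ᵢ Dᵢ = Λᵢ s̃ᵢ`, which forces the diagonal entries of `Λᵢ` hit by nonzero entries of `s̃ᵢ` to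
be among the integers `wᵢ` (`exists_intWeight_of_mul_diagonal`). Finally the `s̃ᵢ` are rescaled
by scalars of product one to determinant one.
-/

set_option linter.dupNamespace false

namespace Summit.MatrixMultiplication.MatrixMultiplication.Theorems

open scoped BigOperators Kronecker
open Matrix
open Literature.Computability.AlgebraicComplexity
open Literature.LinearAlgebra.Matrix

/-! ### Small matrix lemmas -/

/-- If `S A = D S` with `S` invertible then `A S⁻¹ = S⁻¹ D`. -/
theorem mul_inv_eq_inv_mul_of_mul_eq {N : Type*} [Fintype N] [DecidableEq N]
    {S A D : Matrix N N ℂ} (hS : IsUnit S.det) (h : S * A = D * S) :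
    A * S⁻¹ = S⁻¹ * D := by
  calc A * S⁻¹ = S⁻¹ * S * A * S⁻¹ := by rw [Matrix.nonsing_inv_mul _ hS, Matrix.one_mul]
    _ = S⁻¹ * (S * A) * S⁻¹ := by rw [Matrix.mul_assoc S⁻¹]
    _ = S⁻¹ * (D * S) * S⁻¹ := by rw [h]
    _ = S⁻¹ * D := by
      rw [Matrix.mul_assoc, Matrix.mul_assoc, Matrix.mul_nonsing_inv _ hS, Matrix.mul_one]

/-- From `A P = P diag(e)`: `Aᵀ P⁻ᵀ = P⁻ᵀ diag(e)` (`P⁻ᵀ = (P⁻¹)ᵀ = (Pᵀ)⁻¹`). -/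
theorem transpose_mul_inv_transpose_of_mul_eq {N : Type*} [Fintype N] [DecidableEq N]
    {A P : Matrix N N ℂ} {e : N → ℂ} (hP : IsUnit P.det) (h : A * P = P * diagonal e) :
    Aᵀ * P⁻¹ᵀ = P⁻¹ᵀ * diagonal e := by
  have hPt : IsUnit Pᵀ.det := by rwa [Matrix.det_transpose]
  have ht : Pᵀ * Aᵀ = diagonal e * Pᵀ := by
    rw [← Matrix.transpose_mul, h, Matrix.transpose_mul, Matrix.diagonal_transpose]
  rw [Matrix.transpose_nonsing_inv]
  exact mul_inv_eq_inv_mul_of_mul_eq hPt ht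

/-- The intertwining relation: if `ξ = g⁻¹ D g` and `ξ h = h Λ` (all invertible), then
`s̃ := h⁻¹ g⁻¹` satisfies `s̃ D = Λ s̃`. -/
theorem inv_mul_inv_mul_eq {N : Type*} [Fintype N] [DecidableEq N]
    {g h D Λ ξ : Matrix N N ℂ} (hg : IsUnit g.det) (hh : IsUnit h.det) (hξ : ξ = g⁻¹ * D * g)
    (hΛ : ξ * h = h * Λ) : h⁻¹ * g⁻¹ * D = Λ * (h⁻¹ * g⁻¹) := by
  have h1 : g⁻¹ * D = ξ * g⁻¹ := by
    rw [hξ, Matrix.mul_assoc, Matrix.mul_assoc, Matrix.mul_nonsing_inv _ hg, Matrix.mul_one]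
  calc h⁻¹ * g⁻¹ * D = h⁻¹ * (ξ * g⁻¹) := by rw [Matrix.mul_assoc, h1]
    _ = h⁻¹ * (ξ * (h * h⁻¹) * g⁻¹) := by rw [Matrix.mul_nonsing_inv _ hh, Matrix.mul_one]
    _ = h⁻¹ * (ξ * h) * (h⁻¹ * g⁻¹) := by
      simp only [Matrix.mul_assoc]
    _ = h⁻¹ * (h * Λ) * (h⁻¹ * g⁻¹) := by rw [hΛ]
    _ = Λ * (h⁻¹ * g⁻¹) := by
      rw [← Matrix.mul_assoc h⁻¹, Matrix.nonsing_inv_mul _ hh, Matrix.one_mul]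

/-- **Integer weights along a graded invertible matrix**: if `s diag(w) = diag(λ) s` with `s`
invertible and `w` integral, then there are integers `w'` (one for each row) with
`s x' x ≠ 0 → w' x' = w x` — every row of `s` is nonzero, so `λ_{x'}` is one of the `w x`. -/
theorem exists_intWeight_of_mul_diagonal {N : Type*} [Fintype N] [DecidableEq N]
    (s : Matrix N N ℂ) (hs : IsUnit s.det) (w : N → ℤ) (lam : N → ℂ)
    (h : s * diagonal (fun x => (w x : ℂ)) = diagonal lam * s) :
    ∃ w' : N → ℤ, ∀ x' x, s x' x ≠ 0 → w' x' = w x := by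
  have hrow : ∀ x', ∃ x, s x' x ≠ 0 := by
    intro x'
    by_contra hcon
    push Not at hcon
    have : s.det = 0 := Matrix.det_eq_zero_of_row_eq_zero x' hcon
    exact hs.ne_zero this
  choose σ hσ using hrow
  have hentry : ∀ x' x, s x' x ≠ 0 → (w x : ℂ) = lam x' := by
    intro x' x hx
    have := congr_fun (congr_fun h x') x
    rw [mul_diagonal, diagonal_mul] at this
    -- `s x' x * w x = lam x' * s x' x`
    have h2 : s x' x * (w x : ℂ) = s x' x * lam x' := by rw [this, mul_comm]
    exact mul_left_cancel₀ hx h2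
  refine ⟨fun x' => w (σ x'), fun x' x hx => ?_⟩
  have e1 := hentry x' x hx
  have e2 := hentry x' (σ x') (hσ x')
  exact_mod_cast e2.trans e1.symm

/-! ### The Lie condition transported to `⟨n,n,n⟩` -/

section Lie

variable {τ : Type*} [Fintype τ] [DecidableEq τ]

/-- The diagonal Lie operator multiplies the cell `(a,b,c)` by `d₁ a + d₂ b + d₃ c`. -/
theorem lieAct_diagonal_apply (d₁ d₂ d₃ : τ → ℂ) (X : τ → τ → τ → ℂ) (a b c : τ) :
    (actTensor (diagonal d₁) (1 : Matrix τ τ ℂ) 1 X + actTensor (1 : Matrix τ τ ℂ) (diagonal d₂) 1 X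
      + actTensor (1 : Matrix τ τ ℂ) 1 (diagonal d₃) X : τ → τ → τ → ℂ) a b c =
      (d₁ a + d₂ b + d₃ c) * X a b c := by
  simp only [Pi.add_apply]
  rw [actTensor_fst_apply, actTensor_snd_apply, actTensor_thd_apply]
  simp only [diagonal_apply, ite_mul, zero_mul, Finset.sum_ite_eq, Finset.mem_univ, if_true]
  ring

/-- **Transport of the Lie condition.** If the diagonal Lie operator `(D₁, D₂, D₃)` kills
`X = g·M` (`g` invertible), then `(g₁⁻¹D₁g₁, g₂⁻¹D₂g₂, g₃⁻¹D₃g₃)` kills `M`. -/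
theorem lie_transport (g₁ g₂ g₃ D₁ D₂ D₃ : Matrix τ τ ℂ) (hg₁ : IsUnit g₁.det)
    (hg₂ : IsUnit g₂.det) (hg₃ : IsUnit g₃.det) (M : τ → τ → τ → ℂ)
    (hD : actTensor D₁ (1 : Matrix τ τ ℂ) 1 (actTensor g₁ g₂ g₃ M) +
      actTensor (1 : Matrix τ τ ℂ) D₂ 1 (actTensor g₁ g₂ g₃ M) +
      actTensor (1 : Matrix τ τ ℂ) 1 D₃ (actTensor g₁ g₂ g₃ M) = 0) :
    actTensor (g₁⁻¹ * D₁ * g₁) (1 : Matrix τ τ ℂ) 1 M + actTensor (1 : Matrix τ τ ℂ) (g₂⁻¹ * D₂ * g₂) 1 M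
      + actTensor (1 : Matrix τ τ ℂ) 1 (g₃⁻¹ * D₃ * g₃) M = 0 := by
  set L := actTensor (g₁⁻¹ * D₁ * g₁) (1 : Matrix τ τ ℂ) 1 M +
    actTensor (1 : Matrix τ τ ℂ) (g₂⁻¹ * D₂ * g₂) 1 M + actTensor (1 : Matrix τ τ ℂ) 1 (g₃⁻¹ * D₃ * g₃) M
    with hL
  have hgL : actTensor g₁ g₂ g₃ L = 0 := by
    rw [hL, actTensor_add_tensor, actTensor_add_tensor, actTensor_actTensor, actTensor_actTensor,
      actTensor_actTensor, ← hD, actTensor_actTensor, actTensor_actTensor, actTensor_actTensor]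
    have e₁ : g₁ * (g₁⁻¹ * D₁ * g₁) = D₁ * g₁ := by
      rw [← Matrix.mul_assoc, ← Matrix.mul_assoc, Matrix.mul_nonsing_inv _ hg₁, Matrix.one_mul]
    have e₂ : g₂ * (g₂⁻¹ * D₂ * g₂) = D₂ * g₂ := by
      rw [← Matrix.mul_assoc, ← Matrix.mul_assoc, Matrix.mul_nonsing_inv _ hg₂, Matrix.one_mul]
    have e₃ : g₃ * (g₃⁻¹ * D₃ * g₃) = D₃ * g₃ := by
      rw [← Matrix.mul_assoc, ← Matrix.mul_assoc, Matrix.mul_nonsing_inv _ hg₃, Matrix.one_mul]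
    rw [e₁, e₂, e₃]
    simp only [Matrix.mul_one, Matrix.one_mul]
  have : L = actTensor (g₁⁻¹ * g₁) (g₂⁻¹ * g₂) (g₃⁻¹ * g₃) L := by
    rw [Matrix.nonsing_inv_mul _ hg₁, Matrix.nonsing_inv_mul _ hg₂, Matrix.nonsing_inv_mul _ hg₃,
      actTensor_one]
  rw [this, ← actTensor_actTensor, hgL, actTensor_zero]

/-- Undoing a symmetry: if `(h₁,h₂,h₃)·M = M` with `hᵢ` invertible then `(h₁⁻¹,h₂⁻¹,h₃⁻¹)·M = M`. -/
theorem actTensor_inv_of_actTensor_eq (h₁ h₂ h₃ : Matrix τ τ ℂ) (hh₁ : IsUnit h₁.det)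
    (hh₂ : IsUnit h₂.det) (hh₃ : IsUnit h₃.det) (M : τ → τ → τ → ℂ)
    (hM : actTensor h₁ h₂ h₃ M = M) : actTensor h₁⁻¹ h₂⁻¹ h₃⁻¹ M = M := by
  conv_lhs => rw [← hM]
  rw [actTensor_actTensor, Matrix.nonsing_inv_mul _ hh₁, Matrix.nonsing_inv_mul _ hh₂,
    Matrix.nonsing_inv_mul _ hh₃, actTensor_one]

end Lie

/-! ### The straightening theorem -/

/-- **Torus straightening.** Let `g = (g₁,g₂,g₃) ∈ SL³` and integer weights `α, β, γ` be such that
the translate `X = g·⟨n,n,n⟩` is supported on the cells of weight `α a + β b + γ c = 0` (i.e. the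
diagonal one-parameter subgroup of weights `(α,β,γ)` fixes `X`). Then there are `s ∈ SL³` and
integer weights `α', β', γ'` with `s·X = ⟨n,n,n⟩` and `s` graded:
`s₁ a' a ≠ 0 → α' a' = α a`, `s₂ b' b ≠ 0 → β' b' = β b`, `s₃ c' c ≠ 0 → γ' c' = γ c`. -/
theorem straighten {n : ℕ} (hn : 0 < n) (g₁ g₂ g₃ : Matrix (Fin n × Fin n) (Fin n × Fin n) ℂ)
    (hg₁ : g₁.det = 1) (hg₂ : g₂.det = 1) (hg₃ : g₃.det = 1) (α β γ : Fin n × Fin n → ℤ)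
    (hX : ∀ a b c, actTensor g₁ g₂ g₃ (matMulTensor ℂ n n n) a b c ≠ 0 → α a + β b + γ c = 0) :
    ∃ (s₁ s₂ s₃ : Matrix (Fin n × Fin n) (Fin n × Fin n) ℂ) (α' β' γ' : Fin n × Fin n → ℤ),
      s₁.det = 1 ∧ s₂.det = 1 ∧ s₃.det = 1 ∧
      actTensor s₁ s₂ s₃ (actTensor g₁ g₂ g₃ (matMulTensor ℂ n n n)) = matMulTensor ℂ n n n ∧
      (∀ a' a, s₁ a' a ≠ 0 → α' a' = α a) ∧ (∀ b' b, s₂ b' b ≠ 0 → β' b' = β b) ∧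
      (∀ c' c, s₃ c' c ≠ 0 → γ' c' = γ c) := by
  haveI : Nonempty (Fin n) := ⟨⟨0, hn⟩⟩
  set M := matMulTensor ℂ n n n with hM
  have hu₁ : IsUnit g₁.det := by rw [hg₁]; exact isUnit_one
  have hu₂ : IsUnit g₂.det := by rw [hg₂]; exact isUnit_one
  have hu₃ : IsUnit g₃.det := by rw [hg₃]; exact isUnit_one
  -- the diagonal Lie operators and their transports
  set D₁ : Matrix (Fin n × Fin n) (Fin n × Fin n) ℂ := diagonal fun a => (α a : ℂ) with hD₁
  set D₂ : Matrix (Fin n × Fin n) (Fin n × Fin n) ℂ := diagonal fun b => (β b : ℂ) with hD₂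
  set D₃ : Matrix (Fin n × Fin n) (Fin n × Fin n) ℂ := diagonal fun c => (γ c : ℂ) with hD₃
  have hD : actTensor D₁ (1 : Matrix (Fin n × Fin n) (Fin n × Fin n) ℂ) 1 (actTensor g₁ g₂ g₃ M) +
      actTensor (1 : Matrix (Fin n × Fin n) (Fin n × Fin n) ℂ) D₂ 1 (actTensor g₁ g₂ g₃ M) +
      actTensor (1 : Matrix (Fin n × Fin n) (Fin n × Fin n) ℂ) 1 D₃ (actTensor g₁ g₂ g₃ M) = 0 := by
    funext a b c
    rw [hD₁, hD₂, hD₃, lieAct_diagonal_apply]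
    by_cases hz : actTensor g₁ g₂ g₃ M a b c = 0
    · rw [hz, mul_zero]; rfl
    · have := hX a b c hz
      have hwt : ((α a : ℂ) + β b + γ c) = 0 := by exact_mod_cast this
      rw [hwt, zero_mul]; rfl
  have hLie := lie_transport g₁ g₂ g₃ D₁ D₂ D₃ hu₁ hu₂ hu₃ M hD
  -- de Groote, infinitesimal form
  obtain ⟨p, q, r, hξ₁, hξ₂, hξ₃⟩ := (lieStab_matMulTensor_iff _ _ _).mp hLie
  -- `pᵀ`, `r`, `q` are diagonalisable
  have hdiag₂ : (pᵀ ⊗ₖ (1 : Matrix (Fin n) (Fin n) ℂ) + (1 : Matrix (Fin n) (Fin n) ℂ) ⊗ₖ r) * g₂⁻¹ =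
      g₂⁻¹ * D₂ := by
    rw [← hξ₂, Matrix.mul_assoc, Matrix.mul_assoc, Matrix.mul_nonsing_inv _ hu₂, Matrix.mul_one]
  have hneg : (-rᵀ) ⊗ₖ (1 : Matrix (Fin n) (Fin n) ℂ) = -(rᵀ ⊗ₖ (1 : Matrix (Fin n) (Fin n) ℂ)) := by
    ext ⟨i, j⟩ ⟨k, l⟩
    simp
  have hdiag₃ : ((-rᵀ) ⊗ₖ (1 : Matrix (Fin n) (Fin n) ℂ) + (1 : Matrix (Fin n) (Fin n) ℂ) ⊗ₖ q) * g₃⁻¹ =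
      g₃⁻¹ * D₃ := by
    rw [hneg, ← hξ₃, Matrix.mul_assoc, Matrix.mul_assoc, Matrix.mul_nonsing_inv _ hu₃,
      Matrix.mul_one]
  obtain ⟨P, eP, hP, hPe⟩ := exists_mul_eq_mul_diagonal_left_of_kroneckerSum pᵀ r g₂⁻¹
    (fun b => (β b : ℂ)) (Matrix.isUnit_nonsing_inv_det _ hu₂) hdiag₂
  obtain ⟨Q, eQ, hQ, hQe⟩ := exists_mul_eq_mul_diagonal_right_of_kroneckerSum pᵀ r g₂⁻¹
    (fun b => (β b : ℂ)) (Matrix.isUnit_nonsing_inv_det _ hu₂) hdiag₂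
  obtain ⟨R, eR, hR, hRe⟩ := exists_mul_eq_mul_diagonal_right_of_kroneckerSum (-rᵀ) q g₃⁻¹
    (fun c => (γ c : ℂ)) (Matrix.isUnit_nonsing_inv_det _ hu₃) hdiag₃
  -- the sandwich symmetry `h`
  set h₁ : Matrix (Fin n × Fin n) (Fin n × Fin n) ℂ := P⁻¹ᵀ ⊗ₖ R⁻¹ᵀ with hh₁
  set h₂ : Matrix (Fin n × Fin n) (Fin n × Fin n) ℂ := P ⊗ₖ Q with hh₂
  set h₃ : Matrix (Fin n × Fin n) (Fin n × Fin n) ℂ := Q⁻¹ᵀ ⊗ₖ R with hh₃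
  have hhM : actTensor h₁ h₂ h₃ M = M := actTensor_sandwich_matMulTensor P Q R hP hQ hR
  have hPne : P.det ≠ 0 := hP.ne_zero
  have hQne : Q.det ≠ 0 := hQ.ne_zero
  have hRne : R.det ≠ 0 := hR.ne_zero
  have hdet₁ : h₁.det = (P.det ^ n)⁻¹ * (R.det ^ n)⁻¹ := by
    rw [hh₁, Matrix.det_kronecker, Fintype.card_fin, Matrix.det_transpose, Matrix.det_transpose,
      Matrix.det_nonsing_inv, Matrix.det_nonsing_inv]
    simp only [Ring.inverse_eq_inv', inv_pow]
  have hdet₂ : h₂.det = P.det ^ n * Q.det ^ n := by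
    rw [hh₂, Matrix.det_kronecker, Fintype.card_fin]
  have hdet₃ : h₃.det = (Q.det ^ n)⁻¹ * R.det ^ n := by
    rw [hh₃, Matrix.det_kronecker, Fintype.card_fin, Matrix.det_transpose, Matrix.det_nonsing_inv]
    simp only [Ring.inverse_eq_inv', inv_pow]
  have hhu₁ : IsUnit h₁.det := by
    rw [hdet₁, isUnit_iff_ne_zero]
    exact mul_ne_zero (inv_ne_zero (pow_ne_zero _ hPne)) (inv_ne_zero (pow_ne_zero _ hRne))
  have hhu₂ : IsUnit h₂.det := by
    rw [hdet₂, isUnit_iff_ne_zero]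
    exact mul_ne_zero (pow_ne_zero _ hPne) (pow_ne_zero _ hQne)
  have hhu₃ : IsUnit h₃.det := by
    rw [hdet₃, isUnit_iff_ne_zero]
    exact mul_ne_zero (inv_ne_zero (pow_ne_zero _ hQne)) (pow_ne_zero _ hRne)
  have hprod : h₁.det * h₂.det * h₃.det = 1 := by
    rw [hdet₁, hdet₂, hdet₃]
    field_simp
  -- `ξᵢ hᵢ = hᵢ Λᵢ` with `Λᵢ` diagonal
  have hΛ₂ : (g₂⁻¹ * D₂ * g₂) * h₂ = h₂ * diagonal (fun im : Fin n × Fin n => eP im.1 + eQ im.2) := by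
    rw [hξ₂, hh₂, Matrix.add_mul, ← Matrix.mul_kronecker_mul, ← Matrix.mul_kronecker_mul,
      Matrix.one_mul, Matrix.one_mul, hPe, hQe]
    have : diagonal (fun im : Fin n × Fin n => eP im.1 + eQ im.2) =
        diagonal eP ⊗ₖ (1 : Matrix (Fin n) (Fin n) ℂ) + (1 : Matrix (Fin n) (Fin n) ℂ) ⊗ₖ diagonal eQ := by
      ext ⟨i, m⟩ ⟨k, l⟩
      simp only [diagonal_apply, Matrix.add_apply, kronecker_apply, Matrix.one_apply, Prod.mk.injEq]
      by_cases h1 : i = k <;> by_cases h2 : m = l <;> simp [h1, h2]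
    rw [this, Matrix.mul_add, ← Matrix.mul_kronecker_mul, ← Matrix.mul_kronecker_mul, Matrix.mul_one,
      Matrix.mul_one]
  have hQt : rᵀ * Q⁻¹ᵀ = Q⁻¹ᵀ * diagonal eQ := transpose_mul_inv_transpose_of_mul_eq hQ hQe
  have hPt : pᵀᵀ * P⁻¹ᵀ = P⁻¹ᵀ * diagonal eP := transpose_mul_inv_transpose_of_mul_eq hP hPe
  rw [Matrix.transpose_transpose] at hPt
  have hRt : qᵀ * R⁻¹ᵀ = R⁻¹ᵀ * diagonal eR := transpose_mul_inv_transpose_of_mul_eq hR hRe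
  have hΛ₃ : (g₃⁻¹ * D₃ * g₃) * h₃ = h₃ * diagonal (fun mo : Fin n × Fin n => -eQ mo.1 + eR mo.2) := by
    rw [hξ₃, hh₃, Matrix.add_mul, Matrix.neg_mul, ← Matrix.mul_kronecker_mul,
      ← Matrix.mul_kronecker_mul, Matrix.one_mul, Matrix.one_mul, hQt, hRe]
    have : diagonal (fun mo : Fin n × Fin n => -eQ mo.1 + eR mo.2) =
        -(diagonal eQ ⊗ₖ (1 : Matrix (Fin n) (Fin n) ℂ)) + (1 : Matrix (Fin n) (Fin n) ℂ) ⊗ₖ diagonal eR := by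
      ext ⟨m, o⟩ ⟨k, l⟩
      simp only [diagonal_apply, Matrix.add_apply, Matrix.neg_apply, kronecker_apply, Matrix.one_apply,
        Prod.mk.injEq]
      by_cases h1 : m = k <;> by_cases h2 : o = l <;> simp [h1, h2]
    rw [this, Matrix.mul_add, Matrix.mul_neg, ← Matrix.mul_kronecker_mul, ← Matrix.mul_kronecker_mul,
      Matrix.mul_one, Matrix.mul_one]
  have hΛ₁ : (g₁⁻¹ * D₁ * g₁) * h₁ = h₁ * diagonal (fun ij : Fin n × Fin n => -(eP ij.1 + eR ij.2)) := by
    rw [hξ₁, hh₁, Matrix.neg_mul, Matrix.add_mul, ← Matrix.mul_kronecker_mul,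
      ← Matrix.mul_kronecker_mul, Matrix.one_mul, Matrix.one_mul, hPt, hRt]
    have : diagonal (fun ij : Fin n × Fin n => -(eP ij.1 + eR ij.2)) =
        -(diagonal eP ⊗ₖ (1 : Matrix (Fin n) (Fin n) ℂ) + (1 : Matrix (Fin n) (Fin n) ℂ) ⊗ₖ diagonal eR) := by
      ext ⟨i, j⟩ ⟨k, l⟩
      simp only [diagonal_apply, Matrix.add_apply, Matrix.neg_apply, kronecker_apply, Matrix.one_apply,
        Prod.mk.injEq]
      by_cases h1 : i = k <;> by_cases h2 : j = l <;> simp [h1, h2]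
    rw [this, Matrix.mul_neg, Matrix.mul_add, ← Matrix.mul_kronecker_mul, ← Matrix.mul_kronecker_mul,
      Matrix.mul_one, Matrix.mul_one]
  -- the straightening matrices `s̃ᵢ = hᵢ⁻¹ gᵢ⁻¹`
  have hs₁ : h₁⁻¹ * g₁⁻¹ * D₁ = diagonal (fun ij : Fin n × Fin n => -(eP ij.1 + eR ij.2)) * (h₁⁻¹ * g₁⁻¹) :=
    inv_mul_inv_mul_eq hu₁ hhu₁ rfl hΛ₁
  have hs₂ : h₂⁻¹ * g₂⁻¹ * D₂ = diagonal (fun im : Fin n × Fin n => eP im.1 + eQ im.2) * (h₂⁻¹ * g₂⁻¹) :=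
    inv_mul_inv_mul_eq hu₂ hhu₂ rfl hΛ₂
  have hs₃ : h₃⁻¹ * g₃⁻¹ * D₃ = diagonal (fun mo : Fin n × Fin n => -eQ mo.1 + eR mo.2) * (h₃⁻¹ * g₃⁻¹) :=
    inv_mul_inv_mul_eq hu₃ hhu₃ rfl hΛ₃
  have hsu₁ : IsUnit (h₁⁻¹ * g₁⁻¹).det := by
    rw [Matrix.det_mul]
    exact (Matrix.isUnit_nonsing_inv_det _ hhu₁).mul (Matrix.isUnit_nonsing_inv_det _ hu₁)
  have hsu₂ : IsUnit (h₂⁻¹ * g₂⁻¹).det := by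
    rw [Matrix.det_mul]
    exact (Matrix.isUnit_nonsing_inv_det _ hhu₂).mul (Matrix.isUnit_nonsing_inv_det _ hu₂)
  have hsu₃ : IsUnit (h₃⁻¹ * g₃⁻¹).det := by
    rw [Matrix.det_mul]
    exact (Matrix.isUnit_nonsing_inv_det _ hhu₃).mul (Matrix.isUnit_nonsing_inv_det _ hu₃)
  obtain ⟨α', hα'⟩ := exists_intWeight_of_mul_diagonal _ hsu₁ α _ hs₁
  obtain ⟨β', hβ'⟩ := exists_intWeight_of_mul_diagonal _ hsu₂ β _ hs₂
  obtain ⟨γ', hγ'⟩ := exists_intWeight_of_mul_diagonal _ hsu₃ γ _ hs₃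
  -- they map `X` back to `M`
  have hsX : actTensor (h₁⁻¹ * g₁⁻¹) (h₂⁻¹ * g₂⁻¹) (h₃⁻¹ * g₃⁻¹) (actTensor g₁ g₂ g₃ M) = M := by
    rw [actTensor_actTensor, Matrix.mul_assoc, Matrix.mul_assoc, Matrix.mul_assoc,
      Matrix.nonsing_inv_mul _ hu₁, Matrix.nonsing_inv_mul _ hu₂, Matrix.nonsing_inv_mul _ hu₃,
      Matrix.mul_one, Matrix.mul_one, Matrix.mul_one]
    exact actTensor_inv_of_actTensor_eq h₁ h₂ h₃ hhu₁ hhu₂ hhu₃ M hhM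
  -- determinants: product one, then rescale factorwise by scalars of product one
  have hdets : (h₁⁻¹ * g₁⁻¹).det * (h₂⁻¹ * g₂⁻¹).det * (h₃⁻¹ * g₃⁻¹).det = 1 := by
    simp only [Matrix.det_mul, Matrix.det_nonsing_inv, hg₁, hg₂, hg₃, Ring.inverse_one, mul_one]
    simp only [Ring.inverse_eq_inv']
    rw [← mul_inv, ← mul_inv, hprod, inv_one]
  have hNpos : 0 < Fintype.card (Fin n × Fin n) := Fintype.card_pos
  set s₁ := h₁⁻¹ * g₁⁻¹ with hs₁def
  set s₂ := h₂⁻¹ * g₂⁻¹ with hs₂def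
  set s₃ := h₃⁻¹ * g₃⁻¹ with hs₃def
  have hs₁ne : s₁.det ≠ 0 := hsu₁.ne_zero
  have hs₂ne : s₂.det ≠ 0 := hsu₂.ne_zero
  obtain ⟨c₁, hc₁⟩ := IsAlgClosed.exists_pow_nat_eq (s₁.det)⁻¹ hNpos
  obtain ⟨c₂, hc₂⟩ := IsAlgClosed.exists_pow_nat_eq (s₂.det)⁻¹ hNpos
  have hc₁0 : c₁ ≠ 0 := by
    rintro rfl
    rw [zero_pow hNpos.ne'] at hc₁
    exact inv_ne_zero hs₁ne hc₁.symm
  have hc₂0 : c₂ ≠ 0 := by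
    rintro rfl
    rw [zero_pow hNpos.ne'] at hc₂
    exact inv_ne_zero hs₂ne hc₂.symm
  refine ⟨c₁ • s₁, c₂ • s₂, (c₁ * c₂)⁻¹ • s₃, α', β', γ', ?_, ?_, ?_, ?_, ?_, ?_, ?_⟩
  · rw [Matrix.det_smul, hc₁, inv_mul_cancel₀ hs₁ne]
  · rw [Matrix.det_smul, hc₂, inv_mul_cancel₀ hs₂ne]
  · rw [Matrix.det_smul, inv_pow, mul_pow, hc₁, hc₂, mul_inv, inv_inv, inv_inv]
    exact hdets
  · show tripleAct (c₁ • s₁) (c₂ • s₂) ((c₁ * c₂)⁻¹ • s₃) (actTensor g₁ g₂ g₃ M) = M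
    rw [tripleAct_smul, mul_inv_cancel₀ (mul_ne_zero hc₁0 hc₂0), one_smul]
    exact hsX
  · intro a' a h
    refine hα' a' a ?_
    rw [Matrix.smul_apply, smul_eq_mul] at h
    exact right_ne_zero_of_mul h
  · intro b' b h
    refine hβ' b' b ?_
    rw [Matrix.smul_apply, smul_eq_mul] at h
    exact right_ne_zero_of_mul h
  · intro c' c h
    refine hγ' c' c ?_
    rw [Matrix.smul_apply, smul_eq_mul] at h
    exact right_ne_zero_of_mul h

end Summit.MatrixMultiplication.MatrixMultiplication.Theorems
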